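import Mathlib.Probability.Distributions.Gaussian.Multivariate
import Mathlib.Probability.Distributions.Gaussian.CharFun
import Mathlib.Algebra.Order.BigOperators.Ring.Finset
import HarnessLib

/-!
# Linear images of multivariate Gaussians and the compensation trick: `U e + f` is spherical

Topic `Probability/Distributions`. Generic Gaussian algebra on `ℝⁿ = EuclideanSpace ℝ ι` for Mathlib's
`ProbabilityTheory.multivariateGaussian μ S` (covariance matrix `S`), PROVED (no named fact), motivated by
and stated for the step of BLPRS 2013, Lemma 4.7 (the `LWE → extLWE` reduction of
`Literature.Computability.Cryptography.blprs_gapSVP_sqrt_dim_to_lwe_classical`, pqc.S21):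

> *"it then chooses `f` from the continuous Gaussian `D_{α(ξ²I - U'U'ᵀ)^{1/2}}` (which is well defined
> since `ξ²I - U'U'ᵀ` is a positive semidefinite matrix by our assumption on `U`) … Since `Ue` is
> distributed as a continuous Gaussian `D_{αU'}`, the vector `Ue + f` is distributed as a spherical
> continuous Gaussian `D_{αξ}`."* (arXiv:1306.0281, proof of Lemma 4.7)

## Results (`ι, κ` finite index types; `N(S) = multivariateGaussian 0 S`)

* `posSemidef_smul_of_nonneg`, `posSemidef_smul_one` — `c • M`, `c • 1` are positive semidefinite;
* **`multivariateGaussian_map_matrix`** — the image of `N(S)` under the linear map of a (rectangular)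
  matrix `T` is `N(T S Tᵀ)` (`IsGaussian.ext`: same mean, covariance transported by the adjoint `Tᵀ`);
* **`multivariateGaussian_conv`** — `N(S₁) ∗ N(S₂) = N(S₁ + S₂)` (characteristic functions);
* `dotProduct_transpose_mulVec_le_of` — the singular-value bound passes to the transpose:
  `‖U y‖² ≤ ξ²‖y‖² ∀y ⇒ ‖Uᵀ x‖² ≤ ξ²‖x‖² ∀x`; **`posSemidef_sq_smul_one_sub_mul_transpose`** —
  then `ξ²I - UUᵀ` is positive semidefinite (the printed "well defined since … positive semidefinite");
* **`map_matrix_multivariateGaussian_conv_compensation`** — the compensation identity: for `c ≥ 0`,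
  `(N(c I) ∘ U⁻¹) ∗ N(c (ξ²I - UUᵀ)) = N(c ξ² I)` — "`Ue + f` is spherical" with `e ∼ N(cI)` on the
  columns' index type of `U` (`= U'`, the paper's `U` without its first column, acting on the `m - 1`
  noisy coordinates) and the independent compensation `f ∼ N(c(ξ²I - UUᵀ))`.

## References

* Z. Brakerski, A. Langlois, C. Peikert, O. Regev, D. Stehlé, *Classical hardness of learning with errors*,
  STOC 2013; arXiv:1306.0281, proof of Lemma 4.7 (p. 14–15).
-/

noncomputable section

open MeasureTheory ProbabilityTheory Matrix Complex
open scoped ENNReal NNReal Matrix RealInnerProductSpace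

namespace Literature.Probability.Distributions

variable {ι κ : Type} [Fintype ι] [DecidableEq ι] [Fintype κ] [DecidableEq κ]

/-! ### Positive semidefinite bookkeeping -/

omit [DecidableEq ι] in
/-- A nonnegative multiple of a positive semidefinite real matrix is positive semidefinite. [folklore] -/
theorem posSemidef_smul_of_nonneg {M : Matrix ι ι ℝ} (hM : M.PosSemidef) {c : ℝ} (hc : 0 ≤ c) :
    (c • M).PosSemidef := by
  refine .of_dotProduct_mulVec_nonneg (hM.1.smul (IsSelfAdjoint.all c)) fun x => ?_
  rw [smul_mulVec, dotProduct_smul, smul_eq_mul]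
  exact mul_nonneg hc (hM.dotProduct_mulVec_nonneg x)

/-- `c • 1` is positive semidefinite for `c ≥ 0`. [folklore] -/
theorem posSemidef_smul_one {c : ℝ} (hc : 0 ≤ c) : (c • (1 : Matrix ι ι ℝ)).PosSemidef :=
  posSemidef_smul_of_nonneg PosSemidef.one hc

/-! ### Linear images -/

/-- The continuous linear map `ℝ^ι → ℝ^κ` of a rectangular matrix (on `EuclideanSpace`). [folklore] -/
def matrixCLM (T : Matrix κ ι ℝ) : EuclideanSpace ℝ ι →L[ℝ] EuclideanSpace ℝ κ :=
  LinearMap.toContinuousLinearMap (Matrix.toEuclideanLin T)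

omit [DecidableEq κ] in
/-- `matrixCLM T x = T x` in coordinates. [folklore] -/
@[simp] theorem ofLp_matrixCLM (T : Matrix κ ι ℝ) (x : EuclideanSpace ℝ ι) :
    WithLp.ofLp (matrixCLM T x) = T *ᵥ WithLp.ofLp x := rfl

/-- The adjoint of the map of `T` is the map of `Tᵀ`. [folklore] -/
theorem adjoint_matrixCLM (T : Matrix κ ι ℝ) : (matrixCLM T).adjoint = matrixCLM Tᵀ := by
  rw [matrixCLM, matrixCLM, ← LinearMap.adjoint_toContinuousLinearMap,
    ← Matrix.toEuclideanLin_conjTranspose_eq_adjoint, conjTranspose_eq_transpose_of_trivial]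

omit [DecidableEq ι] [DecidableEq κ] in
/-- `(Tᵀ u) ⬝ (S (Tᵀ v)) = u ⬝ ((T S Tᵀ) v)`. [folklore] -/
theorem transpose_mulVec_dotProduct_mulVec (T : Matrix κ ι ℝ) (S : Matrix ι ι ℝ) (u v : κ → ℝ) :
    (Tᵀ *ᵥ u) ⬝ᵥ (S *ᵥ (Tᵀ *ᵥ v)) = u ⬝ᵥ ((T * S * Tᵀ) *ᵥ v) := by
  rw [mulVec_transpose, dotProduct_mulVec, dotProduct_mulVec, dotProduct_mulVec, vecMul_vecMul,
    vecMul_vecMul, Matrix.mul_assoc]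

/-- **Linear image of a multivariate Gaussian**: for a positive semidefinite `S` and any matrix `T`,
`N(0, S) ∘ T⁻¹ = N(0, T S Tᵀ)` (both are Gaussian; means `0`; covariances `u, v ↦ (Tᵀu)ᵀ S (Tᵀv) =
uᵀ (T S Tᵀ) v`). The printed instance: "`Ue` is distributed as `D_{αU'}`". [cite: BrakerskiEtAl2013, Lemma 4.7 (proof)] -/
theorem multivariateGaussian_map_matrix {S : Matrix ι ι ℝ} (hS : S.PosSemidef) (T : Matrix κ ι ℝ) :
    (multivariateGaussian (0 : EuclideanSpace ℝ ι) S).map (matrixCLM T) =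
      multivariateGaussian (0 : EuclideanSpace ℝ κ) (T * S * Tᵀ) := by
  have hS' : (T * S * Tᵀ).PosSemidef := by
    simpa [conjTranspose_eq_transpose_of_trivial] using hS.mul_mul_conjTranspose_same T
  refine IsGaussian.ext ?_ ?_
  · simp only [id_eq]
    rw [ContinuousLinearMap.integral_id_map IsGaussian.integrable_id, integral_id_multivariateGaussian,
      integral_id_multivariateGaussian, map_zero]
  · ext u v
    rw [covarianceBilin_map IsGaussian.memLp_two_id, adjoint_matrixCLM,
      covarianceBilin_multivariateGaussian hS, covarianceBilin_multivariateGaussian hS']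
    exact transpose_mulVec_dotProduct_mulVec T S _ _

/-! ### Sums of independent multivariate Gaussians -/

/-- **`N(0, S₁) ∗ N(0, S₂) = N(0, S₁ + S₂)`**: the sum of independent centred multivariate Gaussians has
the summed covariance (characteristic functions multiply: `exp(-tᵀS₁t/2)·exp(-tᵀS₂t/2)`). [folklore] -/
theorem multivariateGaussian_conv {S₁ S₂ : Matrix ι ι ℝ} (hS₁ : S₁.PosSemidef) (hS₂ : S₂.PosSemidef) :
    multivariateGaussian (0 : EuclideanSpace ℝ ι) S₁ ∗ multivariateGaussian 0 S₂ =
      multivariateGaussian (0 : EuclideanSpace ℝ ι) (S₁ + S₂) := by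
  refine Measure.ext_of_charFun ?_
  funext t
  rw [charFun_conv, charFun_multivariateGaussian hS₁, charFun_multivariateGaussian hS₂,
    charFun_multivariateGaussian (hS₁.add hS₂), ← Complex.exp_add]
  congr 1
  simp only [inner_zero_right, add_mulVec, dotProduct_add]
  push_cast
  ring

/-! ### The compensation covariance is positive semidefinite -/

omit [DecidableEq ι] in
/-- The Cauchy–Schwarz inequality for `dotProduct`. [folklore] -/
theorem dotProduct_sq_le (x y : ι → ℝ) : (x ⬝ᵥ y) ^ 2 ≤ (x ⬝ᵥ x) * (y ⬝ᵥ y) := by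
  have h := Finset.sum_mul_sq_le_sq_mul_sq Finset.univ x y
  simp only [dotProduct, sq] at h ⊢
  simpa [sq] using h

omit [DecidableEq ι] [DecidableEq κ] in
/-- **The operator-norm bound passes to the transpose**: if `‖U y‖² ≤ ξ² ‖y‖²` for all `y` then
`‖Uᵀ x‖² ≤ ξ² ‖x‖²` for all `x` (`‖Uᵀx‖² = ⟨x, U Uᵀ x⟩ ≤ ‖x‖ ξ ‖Uᵀ x‖`). [folklore] -/
theorem dotProduct_transpose_mulVec_le_of (U : Matrix ι κ ℝ) {ξ : ℝ}
    (hU : ∀ y : κ → ℝ, (U *ᵥ y) ⬝ᵥ (U *ᵥ y) ≤ ξ ^ 2 * (y ⬝ᵥ y)) (x : ι → ℝ) :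
    (Uᵀ *ᵥ x) ⬝ᵥ (Uᵀ *ᵥ x) ≤ ξ ^ 2 * (x ⬝ᵥ x) := by
  set w := Uᵀ *ᵥ x with hw
  -- `‖w‖² = x ⬝ (U w)`
  have hww : w ⬝ᵥ w = x ⬝ᵥ (U *ᵥ w) := by
    rw [dotProduct_mulVec x U, ← mulVec_transpose, ← hw]
  have hx0 : 0 ≤ x ⬝ᵥ x := by
    simp only [dotProduct]; exact Finset.sum_nonneg fun i _ => mul_self_nonneg _
  have hw0 : 0 ≤ w ⬝ᵥ w := by
    simp only [dotProduct]; exact Finset.sum_nonneg fun i _ => mul_self_nonneg _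
  -- `(w ⬝ w)² ≤ (x ⬝ x) · ‖U w‖² ≤ (x ⬝ x) · ξ² (w ⬝ w)`
  have h1 : (x ⬝ᵥ (U *ᵥ w)) ^ 2 ≤ (x ⬝ᵥ x) * (ξ ^ 2 * (w ⬝ᵥ w)) :=
    (dotProduct_sq_le x (U *ᵥ w)).trans (mul_le_mul_of_nonneg_left (hU w) hx0)
  rw [← hww] at h1
  rcases hw0.eq_or_lt with h0 | hpos
  · rw [← h0]; positivity
  · rw [sq] at h1
    nlinarith

omit [DecidableEq κ] in
/-- **The compensation covariance `ξ²I - UUᵀ` is positive semidefinite** when `‖U y‖ ≤ ξ‖y‖` for all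
`y` — the printed "well defined since `ξ²I - U'U'ᵀ` is a positive semidefinite matrix by our assumption on
`U`" (largest singular value of `U'` at most `ξ`). [cite: BrakerskiEtAl2013, Lemma 4.7 (proof)] -/
theorem posSemidef_sq_smul_one_sub_mul_transpose (U : Matrix ι κ ℝ) {ξ : ℝ}
    (hU : ∀ y : κ → ℝ, (U *ᵥ y) ⬝ᵥ (U *ᵥ y) ≤ ξ ^ 2 * (y ⬝ᵥ y)) :
    (ξ ^ 2 • (1 : Matrix ι ι ℝ) - U * Uᵀ).PosSemidef := by
  refine .of_dotProduct_mulVec_nonneg ?_ fun x => ?_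
  · refine (isHermitian_one.smul (IsSelfAdjoint.all _)).sub ?_
    simpa [conjTranspose_eq_transpose_of_trivial] using isHermitian_mul_conjTranspose_self U
  · have h := dotProduct_transpose_mulVec_le_of U hU x
    rw [star_trivial, sub_mulVec, dotProduct_sub, smul_mulVec, one_mulVec, dotProduct_smul,
      smul_eq_mul, ← mulVec_mulVec, dotProduct_mulVec, ← mulVec_transpose]
    linarith

/-! ### The compensation identity -/

/-- **"`U e + f` is spherical"**: for `c ≥ 0`, a matrix `U` with `‖U y‖² ≤ ξ²‖y‖²` for all `y`,
`e ∼ N(0, c I)` (on the index type of the columns of `U`) and an independent compensation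
`f ∼ N(0, c(ξ²I - UUᵀ))`, the law of `U e + f` — the convolution of the image of `N(0, cI)` under `U` with
`N(0, c(ξ²I - UUᵀ))` — is the spherical `N(0, c ξ² I)`. [cite: BrakerskiEtAl2013, Lemma 4.7 (proof)] -/
theorem map_matrix_multivariateGaussian_conv_compensation (U : Matrix ι κ ℝ) {c ξ : ℝ} (hc : 0 ≤ c)
    (hU : ∀ y : κ → ℝ, (U *ᵥ y) ⬝ᵥ (U *ᵥ y) ≤ ξ ^ 2 * (y ⬝ᵥ y)) :
    (multivariateGaussian (0 : EuclideanSpace ℝ κ) (c • (1 : Matrix κ κ ℝ))).map (matrixCLM U) ∗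
        multivariateGaussian (0 : EuclideanSpace ℝ ι) (c • (ξ ^ 2 • (1 : Matrix ι ι ℝ) - U * Uᵀ)) =
      multivariateGaussian (0 : EuclideanSpace ℝ ι) ((c * ξ ^ 2) • (1 : Matrix ι ι ℝ)) := by
  rw [multivariateGaussian_map_matrix (posSemidef_smul_one hc) U,
    multivariateGaussian_conv _ (posSemidef_smul_of_nonneg (posSemidef_sq_smul_one_sub_mul_transpose U hU) hc)]
  · congr 1
    rw [Matrix.mul_smul, Matrix.mul_one, Matrix.smul_mul, smul_sub, add_sub_cancel, smul_smul]
  · simpa [conjTranspose_eq_transpose_of_trivial, Matrix.mul_smul, Matrix.smul_mul] using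
      (posSemidef_smul_one (ι := κ) hc).mul_mul_conjTranspose_same U

end Literature.Probability.Distributions

end
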